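import Summits.Ventures.PercRepro.MSTightRemovableSetup

/-!
# (SING-t) at a removable tight-trace element, part II: the fibre count (Cnt)

Dossier proofs/MINE1-theoremS.md, Addendum 36 suppl. 1 (the per-`x` split) and Addendum 37 §1
(the reduction: (Cnt)). In a removable Case I datum with `D = D(P)`, `R = R*(P)`, `K` the partner
family, `Y = F₁ ∖∖ F₀` and `u_N = u₁ ∖ R`, the family of the fibre instance is
`T = {k ∩ R : k ∈ K, u_N ⊆ k}` (the `M`-parts of the partner members over `u_N`). Fibrewise by
the `N`-part `b`: `|K_b| ≤ |Y_b|` (`card_partner_fiber_le`) — the `M`-parts `Z_b` of `K_b` have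
`|Z_b| ≤ |D(Z_b)|` (Marica–Schönheim) and `d ↦ b ∪ d` maps `D(Z_b)` injectively into `Y_b`, as
`b ∪ (y ∖ y') = k ∖ y'` with `y' ∈ P = F₀`. Summing over the fibres, `|Y| = |K| + 1` gives
`|Y_{u_N}| ≤ |K_{u_N}| + 1` (`card_diffsY_fiber_le`); the faces of the fibre instance inject into
`Y_{u_N}` by `z ↦ u_N ∪ z` ((R1)) and `|K_{u_N}| ≤ |T|`, whence **(Cnt)**:
`|L' ∩ ↓T| ≤ |T| + 1` (`card_faces_le`).
-/

namespace PercRepro.MSTight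

open Finset
open scoped FinsetFamily

variable {α : Type*} [DecidableEq α] [Fintype α]

namespace RemovableData

variable {F : Finset (Finset α)} {r : α} {u : Finset α}

/-- The family of the fibre instance: the `M`-parts of the partner members over `u_N`. -/
noncomputable def fibT (F : Finset (Finset α)) (r : α) (u : Finset α) : Finset (Finset α) :=
  ((partner r F).filter fun k => u.erase r \ Rstar (proj r F) ⊆ k).image
    fun k => k ∩ Rstar (proj r F)

/-- Membership in `fibT`. -/
theorem mem_fibT {y : Finset α} :
    y ∈ fibT F r u ↔ ∃ k ∈ partner r F, u.erase r \ Rstar (proj r F) ⊆ k ∧ k ∩ Rstar (proj r F) = y := by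
  simp only [fibT, mem_image, mem_filter]
  constructor
  · rintro ⟨k, ⟨hk, hNk⟩, rfl⟩; exact ⟨k, hk, hNk, rfl⟩
  · rintro ⟨k, hk, hNk, rfl⟩; exact ⟨k, ⟨hk, hNk⟩, rfl⟩

/-- The `M`-part of a member of the trace is a member of the trace. -/
theorem inter_Rstar_mem_proj (d : RemovableData F r u) {p : Finset α} (hp : p ∈ proj r F) :
    p ∩ Rstar (proj r F) ∈ proj r F := by
  rw [mem_iff_parts d.hP]
  obtain ⟨-, hR⟩ := (mem_iff_parts d.hP).1 hp
  refine ⟨?_, ?_⟩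
  · rw [sdiff_eq_empty_iff_subset.2 inter_subset_right]
    exact d.isDownSet_diffs_proj _ hR _ (empty_subset _)
  · rw [sdiff_inter_self_right]; exact hR

/-- A partner member is the union of its `N`-part and its `M`-part. -/
theorem sdiff_union_inter_Rstar (k : Finset α) :
    (k \ Rstar (proj r F)) ∪ (k ∩ Rstar (proj r F)) = k := sdiff_union_inter k _

/-- **The fibre inequality `|K_b| ≤ |Y_b|`.** -/
theorem card_partner_fiber_le (d : RemovableData F r u) (b : Finset α) :
    ((partner r F).filter fun k => k \ Rstar (proj r F) = b).card ≤
      ((diffsY r F).filter fun z => z \ Rstar (proj r F) = b).card := by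
  set R := Rstar (proj r F) with hR
  set Kb := (partner r F).filter fun k => k \ R = b with hKb
  set Zb := Kb.image fun k => k ∩ R with hZb
  -- `|K_b| = |Z_b|`
  have h1 : Kb.card = Zb.card := by
    rw [hZb]
    refine (card_image_of_injOn ?_).symm
    intro k hk k' hk' h
    have hkb := (mem_filter.1 (mem_coe.1 hk)).2
    have hk'b := (mem_filter.1 (mem_coe.1 hk')).2
    rw [← sdiff_union_inter_Rstar k, ← sdiff_union_inter_Rstar k', ← hR, hkb, hk'b]
    simp only at h
    rw [h]
  -- Marica–Schönheim on `Z_b`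
  have h2 : Zb.card ≤ (Zb \\ Zb).card := card_le_card_diffs Zb
  -- `d ↦ b ∪ d` maps `D(Z_b)` into `Y_b` injectively
  have h3 : ((Zb \\ Zb).image fun d => b ∪ d).card = (Zb \\ Zb).card := by
    refine card_image_of_injOn ?_
    intro e he e' he' h
    have hsub : ∀ x ∈ Zb \\ Zb, x ⊆ R := by
      intro x hx
      obtain ⟨y, hy, y', -, rfl⟩ := mem_diffs.1 hx
      obtain ⟨k, -, rfl⟩ := mem_image.1 hy
      exact sdiff_subset.trans inter_subset_right
    have hbR : Disjoint b R := by
      by_cases hne : Kb.Nonempty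
      · obtain ⟨k, hk⟩ := hne
        rw [← (mem_filter.1 hk).2]
        exact disjoint_sdiff_self_left
      · rw [not_nonempty_iff_eq_empty] at hne
        exfalso
        have hZe : Zb = ∅ := by rw [hZb, hne, image_empty]
        have : e ∈ Zb \\ Zb := mem_coe.1 he
        rw [hZe] at this
        simp at this
    have := congrArg (fun s => s ∩ R) h
    simp only at this
    rw [union_inter_distrib_right, union_inter_distrib_right, disjoint_iff_inter_eq_empty.1 hbR,
      empty_union, empty_union, inter_eq_left.2 (hsub e (mem_coe.1 he)),
      inter_eq_left.2 (hsub e' (mem_coe.1 he'))] at this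
    exact this
  have h4 : ((Zb \\ Zb).image fun d => b ∪ d) ⊆ (diffsY r F).filter fun z => z \ R = b := by
    intro z hz
    obtain ⟨e, he, rfl⟩ := mem_image.1 hz
    obtain ⟨y, hy, y', hy', rfl⟩ := mem_diffs.1 he
    obtain ⟨k, hk, rfl⟩ := mem_image.1 hy
    obtain ⟨k', hk', rfl⟩ := mem_image.1 hy'
    obtain ⟨hkK, hkb⟩ := mem_filter.1 hk
    obtain ⟨hk'K, hk'b⟩ := mem_filter.1 hk'
    -- `b ∪ ((k ∩ R) \ (k' ∩ R)) = k \ (k' ∩ R)`, a difference through `r` (`k' ∩ R ∈ P = F₀`)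
    have hy'P : k' ∩ R ∈ part0 r F := by
      rw [d.part0_eq_proj]; exact d.inter_Rstar_mem_proj (d.mem_proj_of_mem_partner hk'K)
    have hkP : k ∈ partr r F := by rw [← d.partner_eq_partr]; exact hkK
    have heq : b ∪ ((k ∩ R) \ (k' ∩ R)) = k \ (k' ∩ R) := by
      rw [← hkb]
      ext a
      simp only [mem_union, mem_sdiff, mem_inter, not_and]
      tauto
    refine mem_filter.2 ⟨?_, ?_⟩
    · rw [heq]; exact mem_diffs.2 ⟨k, hkP, _, hy'P, rfl⟩
    · rw [heq, ← hkb]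
      ext a
      simp only [mem_sdiff, mem_inter, not_and]
      tauto
  have h5 := card_le_card h4
  omega

/-- The fibrewise inequality summed: from `|Y| = |K| + 1`, `|Y_{u_N}| ≤ |K_{u_N}| + 1`. -/
theorem card_diffsY_fiber_le (d : RemovableData F r u) (b : Finset α) :
    ((diffsY r F).filter fun z => z \ Rstar (proj r F) = b).card ≤
      ((partner r F).filter fun k => k \ Rstar (proj r F) = b).card + 1 := by
  set R := Rstar (proj r F) with hR
  have hY : (diffsY r F).card = ∑ c ∈ (univ : Finset (Finset α)),
      ((diffsY r F).filter fun z => z \ R = c).card :=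
    card_eq_sum_card_fiberwise (fun _ _ => mem_univ _)
  have hK : (partner r F).card = ∑ c ∈ (univ : Finset (Finset α)),
      ((partner r F).filter fun k => k \ R = c).card :=
    card_eq_sum_card_fiberwise (fun _ _ => mem_univ _)
  have hYb := Finset.add_sum_erase (univ : Finset (Finset α))
    (fun c => ((diffsY r F).filter fun z => z \ R = c).card) (mem_univ b)
  have hKb := Finset.add_sum_erase (univ : Finset (Finset α))
    (fun c => ((partner r F).filter fun k => k \ R = c).card) (mem_univ b)
  have hle : ∑ c ∈ (univ : Finset (Finset α)).erase b, ((partner r F).filter fun k => k \ R = c).card ≤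
      ∑ c ∈ (univ : Finset (Finset α)).erase b, ((diffsY r F).filter fun z => z \ R = c).card :=
    Finset.sum_le_sum fun c _ => d.card_partner_fiber_le c
  have hcard := d.card_diffsY
  omega

/-- The faces of the fibre instance inject into `Y_{u_N}` by `z ↦ u_N ∪ z`. -/
theorem card_faces_le_card_fiber (d : RemovableData F r u) :
    (((proj r F \\ proj r F).filter fun w => w ⊆ Rstar (proj r F)).filter
      fun w => ∃ y ∈ fibT F r u, w ⊆ y).card ≤
      ((diffsY r F).filter fun z => z \ Rstar (proj r F) = u.erase r \ Rstar (proj r F)).card := by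
  set R := Rstar (proj r F) with hR
  set uN := u.erase r \ R with huN
  refine card_le_card_of_injOn (fun z => uN ∪ z) ?_ ?_
  · intro z hz
    obtain ⟨hz, y, hy, hzy⟩ := mem_filter.1 (mem_coe.1 hz)
    obtain ⟨hzD, hzR⟩ := mem_filter.1 hz
    obtain ⟨k, hk, hNk, rfl⟩ := mem_fibT.1 hy
    have hdisj : Disjoint uN R := disjoint_sdiff_self_left
    refine mem_coe.2 (mem_filter.2 ⟨?_, ?_⟩)
    · rw [d.mem_diffsY_iff_faces]
      refine ⟨?_, k, hk, union_subset hNk (hzy.trans inter_subset_left)⟩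
      rw [mem_diffs_iff_parts d.hP d.isDownSet_diffs_proj]
      constructor
      · rw [union_sdiff_distrib, sdiff_eq_self_of_disjoint hdisj, sdiff_eq_empty_iff_subset.2 hzR,
          union_empty]
        exact ((mem_iff_parts d.hP).1 d.erase_mem_proj).1
      · rw [union_inter_distrib_right, disjoint_iff_inter_eq_empty.1 hdisj, empty_union,
          inter_eq_left.2 hzR]
        exact hzD
    · rw [union_sdiff_distrib, sdiff_eq_self_of_disjoint hdisj, sdiff_eq_empty_iff_subset.2 hzR,
        union_empty]
  · intro z hz z' hz' h
    have hzR := (mem_filter.1 (mem_filter.1 (mem_coe.1 hz)).1).2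
    have hz'R := (mem_filter.1 (mem_filter.1 (mem_coe.1 hz')).1).2
    have hdisj : Disjoint uN R := disjoint_sdiff_self_left
    have := congrArg (fun s => s ∩ R) h
    simp only at this
    rw [union_inter_distrib_right, union_inter_distrib_right, disjoint_iff_inter_eq_empty.1 hdisj,
      empty_union, empty_union, inter_eq_left.2 hzR, inter_eq_left.2 hz'R] at this
    exact this

/-- `|K_{u_N}| ≤ |T|`. -/
theorem card_partner_fiber_le_card_fibT :
    ((partner r F).filter fun k => k \ Rstar (proj r F) = u.erase r \ Rstar (proj r F)).card ≤
      (fibT F r u).card := by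
  refine card_le_card_of_injOn (fun k => k ∩ Rstar (proj r F)) ?_ ?_
  · intro k hk
    obtain ⟨hkK, hkb⟩ := mem_filter.1 (mem_coe.1 hk)
    exact mem_coe.2 (mem_fibT.2 ⟨k, hkK, hkb ▸ sdiff_subset, rfl⟩)
  · intro k hk k' hk' h
    have hkb := (mem_filter.1 (mem_coe.1 hk)).2
    have hk'b := (mem_filter.1 (mem_coe.1 hk')).2
    rw [← sdiff_union_inter_Rstar k, ← sdiff_union_inter_Rstar k', hkb, hk'b]
    simp only at h
    rw [h]

/-- **(Cnt) for the fibre instance:** `|L' ∩ ↓T| ≤ |T| + 1`. -/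
theorem card_faces_le (d : RemovableData F r u) :
    (((proj r F \\ proj r F).filter fun w => w ⊆ Rstar (proj r F)).filter
      fun w => ∃ y ∈ fibT F r u, w ⊆ y).card ≤ (fibT F r u).card + 1 := by
  have h1 := d.card_faces_le_card_fiber
  have h2 := d.card_diffsY_fiber_le (u.erase r \ Rstar (proj r F))
  have h3 := card_partner_fiber_le_card_fibT (F := F) (r := r) (u := u)
  omega

end RemovableData

end PercRepro.MSTight
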